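import Literature.Computability.MetaComplexity.DistProblems

/-!
# PneNP / SzkEntropy — crux `PeaWorstToAvg` (stmt-PneNP-10777), negative side:
# exactly samplable laws are DYADIC (no exact uniform sampler of `GL_n(F₂)`, of an orbit, of `ℤ_N^*`)

Standing-disprover boundary fact for BOTH picked lines of the crux (`dual-mode-compile`: certified mode
samplers, socket pairs "QR/DDH/DCR/LWE modes"; `orbit-pair-rsr`: planted orbit samplers): the tree's
samplers are `RandAlg`s reading exactly `coinLen |1ⁿ|` fair coins, and `Ensemble.IsPolySamplable` is
EXACT sampling (Bogdanov–Trevisan's `PSamp`, exact version).  Hence: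

* `randAlg_outputPMF_apply_eq_card_div` — every atom of an output law has mass `k / 2^{coinLen}`;
* `randAlg_card_dvd_of_outputPMF_uniform` — if the output law on some input is UNIFORM on a finite set
  `S`, then `|S|` divides `2^{coinLen}` (so `|S|` is a power of two);
* `not_isPolySamplable_of_uniform_three` — e.g. an ensemble uniform on three strings at some parameter is
  not `IsPolySamplable`; the same for `|GL₂(F₂)| = 6`, `|GLₙ(F₂)| = 2^{n(n-1)/2}∏(2ⁱ-1)`, an affine orbit
  with an odd-order factor, `|ℤ_N^*|`, `|QR_N|` (`card_dvd_two_pow_of_isPolySamplable_uniform`).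

So every "uniform orbit / uniform group element" law in a kit must be the law of a TRUNCATED rejection
sampler (as `Lines/orbit-pair-rsr.lean` does), and number-theoretic mode pairs plugged into the socket
theorems of `Lines/dual-mode-compile.lean` §5 must be dyadic approximations whose indistinguishability is
argued for the approximations — a stub or glue lemma asserting exact samplability of a non-dyadic uniform
law is refuted by `card_dvd_two_pow_of_isPolySamplable_uniform`.

References: A. Bogdanov, L. Trevisan, *Average-Case Complexity* (2006), Def. 2.1 (`PSamp`, exact);
S. Arora, B. Barak, *Computational Complexity* (2009), Def. 7.1, §7.4.1; D. E. Knuth, A. C. Yao, *The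
complexity of nonuniform random number generation*, in: Algorithms and Complexity (1976).
-/

namespace Summit.PneNP.PneNP.Theorems

open Literature.Computability.Complexity Literature.Computability.MetaComplexity
open _root_.Computability
open scoped ENNReal

variable {α β : Type}

/-- **Atoms of an output law are dyadic**: on input `x` with `c = coinLen |ea x|` coins, the mass of the
output `b` is `#{r ∈ {0,1}ᶜ | run x r = b} / 2ᶜ`. [AroraBarak2009, Def. 7.1] -/
theorem randAlg_outputPMF_apply_eq_card_div [DecidableEq β] (A : RandAlg α β) (ea : α → List Bool)
    (x : α) (b : β) :
    A.outputPMF ea x b =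
      ((Finset.univ.filter fun r : List.Vector Bool (A.coinLen (ea x).length) => b = A.run x r.toList).card
        : ℝ≥0∞) * (2 ^ A.coinLen (ea x).length : ℝ≥0∞)⁻¹ := by
  classical
  rw [RandAlg.outputPMF, PMF.map_apply, tsum_fintype]
  simp only [PMF.uniformOfFintype_apply, card_vector, Fintype.card_bool]
  rw [Finset.sum_ite, Finset.sum_const_zero, add_zero, Finset.sum_const, nsmul_eq_mul]
  push_cast
  congr

/-- **Uniform output laws have dyadic support size**: if on some input the output law gives each element
of a nonempty finite set `S` mass `1/|S|`, then `|S| ∣ 2^{coinLen}`. [KnuthYao1976; AroraBarak2009, §7.4.1] -/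
theorem randAlg_card_dvd_of_outputPMF_uniform [DecidableEq β] (A : RandAlg α β) (ea : α → List Bool)
    (x : α) (S : Finset β) (hS : S.Nonempty)
    (hunif : ∀ b ∈ S, A.outputPMF ea x b = (S.card : ℝ≥0∞)⁻¹) :
    S.card ∣ 2 ^ A.coinLen (ea x).length := by
  classical
  obtain ⟨b, hb⟩ := hS
  have h := hunif b hb
  rw [randAlg_outputPMF_apply_eq_card_div] at h
  set k := (Finset.univ.filter fun r : List.Vector Bool (A.coinLen (ea x).length) =>
    b = A.run x r.toList).card
  set c := A.coinLen (ea x).length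
  have hSpos : (0 : ℝ) < S.card := by exact_mod_cast Finset.card_pos.2 ⟨b, hb⟩
  -- pass to real numbers and clear denominators: `k · |S| = 2^c`
  have h' := congrArg ENNReal.toReal h
  rw [ENNReal.toReal_mul, ENNReal.toReal_inv, ENNReal.toReal_inv, ENNReal.toReal_pow,
    ENNReal.toReal_natCast, ENNReal.toReal_natCast, ENNReal.toReal_ofNat] at h'
  have hreal : (k : ℝ) * S.card = 2 ^ c := by
    field_simp at h'
    linarith
  exact Dvd.intro_left k (by exact_mod_cast hreal)

/-- **An exactly samplable ensemble has dyadic uniform slices**: if `D` is `IsPolySamplable` and `D n` is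
uniform on a nonempty finite set `S` of strings, then `|S|` divides a power of two.
[BogdanovTrevisan2006, Def. 2.1; KnuthYao1976] -/
theorem card_dvd_two_pow_of_isPolySamplable_uniform {D : Ensemble} (hD : D.IsPolySamplable) (n : ℕ)
    (S : Finset (List Bool)) (hS : S.Nonempty) (hunif : ∀ w ∈ S, D n w = (S.card : ℝ≥0∞)⁻¹) :
    ∃ c : ℕ, S.card ∣ 2 ^ c := by
  obtain ⟨A, -, hA⟩ := hD
  refine ⟨A.coinLen (unaryEncodeNat n).length, randAlg_card_dvd_of_outputPMF_uniform A unaryEncodeNat n S hS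
    fun w hw => ?_⟩
  rw [hA n]
  exact hunif w hw

/-- **No exact sampler of a uniform law on three strings** (`3 ∤ 2ᶜ`): e.g. the ensemble uniform on
`{[], [0], [1]}` at every parameter is not `IsPolySamplable`; verbatim for `|GL₂(F₂)| = 6` and every set
whose size has an odd factor `> 1`. [KnuthYao1976; BogdanovTrevisan2006, Def. 2.1] -/
theorem not_isPolySamplable_of_uniform_three {D : Ensemble} (n : ℕ) (S : Finset (List Bool))
    (hS : S.card = 3) (hunif : ∀ w ∈ S, D n w = (S.card : ℝ≥0∞)⁻¹) : ¬ D.IsPolySamplable := by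
  intro hD
  obtain ⟨c, hc⟩ := card_dvd_two_pow_of_isPolySamplable_uniform hD n S
    (Finset.card_pos.1 (by omega)) hunif
  rw [hS] at hc
  have := Nat.Prime.dvd_of_dvd_pow Nat.prime_three hc
  omega

end Summit.PneNP.PneNP.Theorems
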